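import Summits.Ventures.PercRepro.ThetaMultiRel

/-!
# (Θ_∞): the Marica–Schönheim projection step

Dossier proofs/MINE1-theoremS.md, Addendum 73–74 (mine-1, gen 38). With the relative family
`multiDRel U A`, the projection `projE e A` and the partner family `partE e A` of
ThetaMultiRel.lean, the classical bookkeeping of the Marica–Schönheim induction ((L1) of Theorem
S, `MSTightProj.lean`) holds class by class:

* `card_multiDRel_projE_add_partE_le` — **the projection step**:
  `|multiDRel (U ∖ e) (projE e A)| + |multiDRel (U ∖ e) (partE e A)| ≤ |multiDRel U A|`
  whenever `e ∈ U` and some partner exists (`card_multiDRel_projE_le` without the partner term,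
  unconditionally): split `multiDRel U A` by `e`, project the part containing `e`; the projected
  instance's family lies in the union of the two parts and the partner instance's family in their
  intersection — with no validity hypothesis at all;
* `sum_card_le_card_multiDRel_of_projE` — **the induction step**: if (Θ_∞) holds on `U ∖ e` for
  the projected instance and for the partner instance, it holds on `U` for `A`.

So (Θ_∞) on `U` follows from (Θ_∞) on `U ∖ e` at every point `e` with a consistent projection
(`multiValidRel_projE`) — the exact step of Addendum 73; the Split Lemma (which point, which
partner labels when every point is inconsistent) is what remains.
-/

namespace PercRepro.MSTight

open Finset
open scoped FinsetFamily

variable {α : Type*} [DecidableEq α] [Fintype α]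
variable {ι : Type*} [DecidableEq ι] [Fintype ι]

section ProjStep

variable {U : Finset α} {e : α} {A : ι → Finset (Finset α)}

omit [Fintype α] in
/-- The projected family lies in the projection of `multiDRel U A`: every member is `E ∖ e` for a
member `E` of the original family. -/
theorem exists_erase_eq_of_mem_multiDRel_projE {E' : Finset α}
    (h : E' ∈ multiDRel (U.erase e) (projE e A)) : ∃ E ∈ multiDRel U A, E.erase e = E' := by
  rw [mem_multiDRel] at h
  rcases h with rfl | ⟨i, h⟩ | ⟨i, j, hij, h⟩
  · exact ⟨∅, empty_mem_multiDRel U A, erase_empty e⟩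
  · rw [mem_diffs] at h
    obtain ⟨x', hx', y', hy', rfl⟩ := h
    obtain ⟨x, hx, rfl⟩ := mem_projE.1 hx'
    obtain ⟨y, hy, rfl⟩ := mem_projE.1 hy'
    exact ⟨x \ y, mem_multiDRel_of_mem_diffs i (sdiff_mem_diffs hx hy), (erase_sdiff_erase' x y).symm⟩
  · rw [mem_crossDRel] at h
    rcases h with ⟨x', hx', y', hy', rfl⟩ | ⟨x', hx', y', hy', rfl⟩
    · obtain ⟨x, hx, rfl⟩ := mem_projE.1 hx'
      obtain ⟨y, hy, rfl⟩ := mem_projE.1 hy'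
      exact ⟨x ⊓ y, inf_mem_multiDRel hij hx hy, (erase_inf_erase' x y).symm⟩
    · obtain ⟨x, hx, rfl⟩ := mem_projE.1 hx'
      obtain ⟨y, hy, rfl⟩ := mem_projE.1 hy'
      exact ⟨U \ (x ⊔ y), sdiff_sup_mem_multiDRel hij hx hy, (erase_sdiff_sup_erase' U x y).symm⟩

omit [Fintype α] in
/-- The partner family's members are `e`-free members of `multiDRel U A` whose `e`-extension is a
member too — given `e ∈ U` and at least one partner pair. -/
theorem mem_and_insert_mem_of_mem_multiDRel_partE (hU : e ∈ U)
    (hK : ∃ i, (partE e A i).Nonempty) {E' : Finset α}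
    (h : E' ∈ multiDRel (U.erase e) (partE e A)) :
    E' ∈ multiDRel U A ∧ e ∉ E' ∧ insert e E' ∈ multiDRel U A := by
  rw [mem_multiDRel] at h
  rcases h with rfl | ⟨i, h⟩ | ⟨i, j, hij, h⟩
  · obtain ⟨i, z, hz⟩ := hK
    obtain ⟨hzA, hez, hzeA⟩ := mem_partE.1 hz
    refine ⟨empty_mem_multiDRel U A, notMem_empty e, ?_⟩
    have hd : insert e z \ z ∈ A i \\ A i := sdiff_mem_diffs hzeA hzA
    rw [insert_sdiff_of_notMem _ hez, sdiff_self, bot_eq_empty] at hd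
    exact mem_multiDRel_of_mem_diffs i hd
  · rw [mem_diffs] at h
    obtain ⟨z, hz, w, hw, rfl⟩ := h
    obtain ⟨hzA, hez, hzeA⟩ := mem_partE.1 hz
    obtain ⟨hwA, hew, -⟩ := mem_partE.1 hw
    refine ⟨mem_multiDRel_of_mem_diffs i (sdiff_mem_diffs hzA hwA), fun hh => hez (mem_sdiff.1 hh).1,
      ?_⟩
    have hd : insert e z \ w ∈ A i \\ A i := sdiff_mem_diffs hzeA hwA
    rw [insert_sdiff_of_notMem _ hew] at hd
    exact mem_multiDRel_of_mem_diffs i hd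
  · rw [mem_crossDRel] at h
    rcases h with ⟨z, hz, w, hw, rfl⟩ | ⟨z, hz, w, hw, rfl⟩
    · obtain ⟨hzA, hez, hzeA⟩ := mem_partE.1 hz
      obtain ⟨hwA, hew, hweA⟩ := mem_partE.1 hw
      refine ⟨inf_mem_multiDRel hij hzA hwA, fun hh => hez (mem_inter.1 hh).1, ?_⟩
      have hm := inf_mem_multiDRel (U := U) hij hzeA hweA
      rwa [inf_eq_inter, ← insert_inter_distrib, ← inf_eq_inter] at hm
    · obtain ⟨hzA, hez, hzeA⟩ := mem_partE.1 hz
      obtain ⟨hwA, hew, hweA⟩ := mem_partE.1 hw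
      have hzw : (U.erase e) \ (z ⊔ w) = U \ (insert e z ⊔ insert e w) := by
        ext a
        simp only [sup_eq_union, mem_sdiff, mem_erase, mem_union, mem_insert]
        tauto
      refine ⟨?_, fun hh => (mem_erase.1 (mem_sdiff.1 hh).1).1 rfl, ?_⟩
      · rw [hzw]
        exact sdiff_sup_mem_multiDRel hij hzeA hweA
      · have hi : insert e ((U.erase e) \ (z ⊔ w)) = U \ (z ⊔ w) := by
          ext a
          simp only [sup_eq_union, mem_insert, mem_sdiff, mem_erase, mem_union]
          constructor
          · rintro (rfl | ⟨⟨-, ha⟩, hzw'⟩)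
            · exact ⟨hU, fun hh => hh.elim (fun h' => hez h') fun h' => hew h'⟩
            · exact ⟨ha, hzw'⟩
          · rintro ⟨ha, hzw'⟩
            by_cases hae : a = e
            · exact Or.inl hae
            · exact Or.inr ⟨⟨hae, ha⟩, hzw'⟩
        rw [hi]
        exact sdiff_sup_mem_multiDRel hij hzA hwA

omit [Fintype α] in
/-- The `e`-part of the family, projected, is as large as the `e`-part. -/
theorem card_filter_mem_image_erase (D : Finset (Finset α)) :
    ((D.filter fun E => e ∈ E).image fun E => E.erase e).card = (D.filter fun E => e ∈ E).card :=
  card_image_of_injOn fun _ hE _ hF h => erase_injOn' e (mem_filter.1 hE).2 (mem_filter.1 hF).2 h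

omit [Fintype α] in
/-- **The projection step without the partner term**: the projected family is at most as large
as the family. -/
theorem card_multiDRel_projE_le :
    (multiDRel (U.erase e) (projE e A)).card ≤ (multiDRel U A).card := by
  set D := multiDRel U A with hD
  have hsplit : D.card = (D.filter fun E => e ∈ E).card + (D.filter fun E => e ∉ E).card :=
    (card_filter_add_card_filter_not (s := D) fun E => e ∈ E).symm
  have hsub : multiDRel (U.erase e) (projE e A) ⊆
      ((D.filter fun E => e ∈ E).image fun E => E.erase e) ∪ (D.filter fun E => e ∉ E) := by
    intro E' hE'
    obtain ⟨E, hE, rfl⟩ := exists_erase_eq_of_mem_multiDRel_projE hE'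
    rw [mem_union]
    by_cases he : e ∈ E
    · exact Or.inl (mem_image.2 ⟨E, mem_filter.2 ⟨hE, he⟩, rfl⟩)
    · rw [erase_eq_of_notMem he]
      exact Or.inr (mem_filter.2 ⟨hE, he⟩)
  calc (multiDRel (U.erase e) (projE e A)).card
      ≤ (((D.filter fun E => e ∈ E).image fun E => E.erase e) ∪ (D.filter fun E => e ∉ E)).card :=
        card_le_card hsub
    _ ≤ ((D.filter fun E => e ∈ E).image fun E => E.erase e).card +
          (D.filter fun E => e ∉ E).card := card_union_le _ _
    _ = D.card := by rw [card_filter_mem_image_erase, hsplit]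

omit [Fintype α] in
/-- **The projection step** (the multi-class (L1) of Theorem S): for `e ∈ U` and at least one
partner pair, `|multiDRel (U ∖ e) (projE e A)| + |multiDRel (U ∖ e) (partE e A)| ≤ |multiDRel U A|`.
No validity is assumed. -/
theorem card_multiDRel_projE_add_partE_le (hU : e ∈ U) (hK : ∃ i, (partE e A i).Nonempty) :
    (multiDRel (U.erase e) (projE e A)).card + (multiDRel (U.erase e) (partE e A)).card ≤
      (multiDRel U A).card := by
  set D := multiDRel U A with hD
  set De' := (D.filter fun E => e ∈ E).image fun E => E.erase e with hDe'
  set Dn := D.filter fun E => e ∉ E with hDn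
  have hsplit : D.card = (D.filter fun E => e ∈ E).card + Dn.card :=
    (card_filter_add_card_filter_not (s := D) fun E => e ∈ E).symm
  have hP : multiDRel (U.erase e) (projE e A) ⊆ De' ∪ Dn := by
    intro E' hE'
    obtain ⟨E, hE, rfl⟩ := exists_erase_eq_of_mem_multiDRel_projE hE'
    rw [mem_union]
    by_cases he : e ∈ E
    · exact Or.inl (mem_image.2 ⟨E, mem_filter.2 ⟨hE, he⟩, rfl⟩)
    · rw [erase_eq_of_notMem he]
      exact Or.inr (mem_filter.2 ⟨hE, he⟩)
  have hKsub : multiDRel (U.erase e) (partE e A) ⊆ De' ∩ Dn := by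
    intro E' hE'
    obtain ⟨h1, h2, h3⟩ := mem_and_insert_mem_of_mem_multiDRel_partE hU hK hE'
    rw [mem_inter]
    refine ⟨mem_image.2 ⟨insert e E', mem_filter.2 ⟨h3, mem_insert_self e E'⟩, erase_insert h2⟩,
      mem_filter.2 ⟨h1, h2⟩⟩
  calc (multiDRel (U.erase e) (projE e A)).card + (multiDRel (U.erase e) (partE e A)).card
      ≤ (De' ∪ Dn).card + (De' ∩ Dn).card :=
        Nat.add_le_add (card_le_card hP) (card_le_card hKsub)
    _ = De'.card + Dn.card := card_union_add_card_inter _ _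
    _ = D.card := by rw [hDe', card_filter_mem_image_erase, hsplit]

end ProjStep

section ProjCorollary

variable {e : α} {A : ι → Finset (Finset α)}

omit [Fintype α] in
/-- **The induction step of (Θ_∞)**: if the relative conjecture holds on `U ∖ e` for the projected
instance and for the partner instance, it holds on `U` for `A` (`e ∈ U`). -/
theorem sum_card_le_card_multiDRel_of_projE {U : Finset α} (hU : e ∈ U)
    (hP : ∑ i, (projE e A i).card ≤ (multiDRel (U.erase e) (projE e A)).card)
    (hK : ∑ i, (partE e A i).card ≤ (multiDRel (U.erase e) (partE e A)).card) :
    ∑ i, (A i).card ≤ (multiDRel U A).card := by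
  have hsum : ∑ i, (A i).card = ∑ i, (projE e A i).card + ∑ i, (partE e A i).card := by
    rw [← sum_add_distrib]
    exact Finset.sum_congr rfl fun i _ => (card_projE_add_card_partE i).symm
  by_cases hpart : ∃ i, (partE e A i).Nonempty
  · calc ∑ i, (A i).card = ∑ i, (projE e A i).card + ∑ i, (partE e A i).card := hsum
      _ ≤ (multiDRel (U.erase e) (projE e A)).card + (multiDRel (U.erase e) (partE e A)).card :=
          Nat.add_le_add hP hK
      _ ≤ (multiDRel U A).card := card_multiDRel_projE_add_partE_le hU hpart
  · simp only [not_exists, not_nonempty_iff_eq_empty] at hpart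
    have hzero : ∑ i, (partE e A i).card = 0 :=
      Finset.sum_eq_zero fun i _ => by rw [card_eq_zero]; exact hpart i
    calc ∑ i, (A i).card = ∑ i, (projE e A i).card + ∑ i, (partE e A i).card := hsum
      _ = ∑ i, (projE e A i).card := by rw [hzero, Nat.add_zero]
      _ ≤ (multiDRel (U.erase e) (projE e A)).card := hP
      _ ≤ (multiDRel U A).card := card_multiDRel_projE_le

end ProjCorollary

end PercRepro.MSTight
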